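/-
Copyright (c) 2026 the pub-hodgecm-mathlib formalisation cell (harness21).  Prover seat hodgecm-mathlib-K2E1-p16 (g4), Track B ∕ K2-LIT, h413 = `stmt-HodgeConjecture-24833`,
R90-TF section S8 «ContSpec-n½», socket (E) :276 (N₃) row, S8 dealer R90-CS-plan (g4) S8-R254 (8)+(9) (E1-PLANCHEREL BODY cut into bricks; joint census
`R90/S8/CENSUS-PlancherelBody-bricks.K2E1-p16-F0P2-p10.md`, brick PB-3b): the (L3) letter `hline` of ★ D5′ for symbol families of SATAKE SHAPE on the unitary axis —
`s_{v₀}(y) = a·e^{ity} + b·e^{−ity} + c` with `t ≠ 0`, `(a, b) ≠ (0, 0)` — from ★ (α) `K2E1AnalyticLevelSetNullU`.  Mathlib + ★ (α) only.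
-/
import Summits.HodgeConjecture.HodgeConjecture.Theorems.K2E1AnalyticLevelSetNullU   -- ★ (α) p86xxxx (K2E4-p23): `volume_levelSet_line_eq_zero`, `measure_inter_setOf_forall_eq_zero_of_exists`
import Mathlib.Analysis.SpecialFunctions.Complex.Analytic                         -- `AnalyticAt.cexp` (entire symbols)
import Mathlib.Analysis.SpecialFunctions.Trigonometric.Basic
import Mathlib.Analysis.SpecialFunctions.Log.Basic
import HarnessLib

/-!
# R90-TF · S8 «ContSpec-n½» — `R90S8PlancherelLineLetterOfSatakeSymbolU3`: THE (L3) LETTER `hline` FOR SATAKE-SHAPED SYMBOLS (brick PB-3b of the E1-Plancherel body at a τ-cut block)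

Cell `hodgecm-mathlib`, crux H413 (`stmt-HodgeConjecture-24833`, lane `--supports … --as helper`), route of record `HCCMUnconditional`; R90-TF section S8, socket (E) `sock_S8_res_exhaustion_le_closure`
(B ED. 7 :276), (N₃) row per `K_∞`-type; the bill of ★ `resG_isotypic_le_orthogonal_of_lineModel_of_conv` ∕ ★ `hNblk_of_record_of_conv` carries (L3) `hline : ∀ c, m {x | ∀ j, s j x = c j} = 0`
for the symbol family `s : J → Ω → ℂ` of the (L2) model.  THEOREMS ONLY (no `def`, no `instance`, no `notation`, no named-fact hypothesis, no `sorry`; default heartbeats); count-neutral;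
CLOSES NO SOCKET.

THE MATHEMATICS ([ReedSimonI1980] §VII.2; [Conway1978] IV §3; [Cartier1979] §IV (Satake)).  In the adopted design of the τ-cut Plancherel model (census PB) the model space is the unitary axis
`Ω := ℝ` (`z = 1 + iy`) with Lebesgue measure and the commuting family `T_v` (`v ∤ 𝔫`, unramified Hecke operators) acts on the Plancherel coordinate by the SATAKE SCALARS
`s_v(y) = λ_v(χ₁, χ₂; 1 + iy)`, which along the axis have the shape `a_v·q_v^{iyk} + b_v·q_v^{−iyk} + c_v = a_v·e^{i t_v y} + b_v·e^{−i t_v y} + c_v`, `t_v = k·log q_v ≠ 0`.  Such a function of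
`y` is the restriction to the line `y ↦ 0 + y·i` of the ENTIRE function `S(z) = a·e^{tz} + b·e^{−tz} + c`, and it is NOT constant as soon as `(a, b) ≠ (0, 0)` (evaluate at `y = 0, π∕t,
π∕(2t)`: constancy forces `a + b = 0` and `(a − b)·i = 0`).  Hence by ★ (α) `volume_levelSet_line_eq_zero` every level set `{y | s_{v₀}(y) = c}` is Lebesgue-null, and ONE such index `v₀`
makes the joint level set null (★ (α) `measure_inter_setOf_forall_eq_zero_of_exists`) — the letter `hline` VERBATIM (`m := volume`, `Ω := ℝ`).  Hypothesis-first on the SHAPE of one symbol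
only: no Satake computation is performed here (that is brick PB-3a).
* §1 `expSymbol_not_const` — `y ↦ a e^{ity} + b e^{−ity} + c` takes two different values (`t ≠ 0`, `(a,b) ≠ 0`).
* §2 **`hline_of_expSymbol`** — `∀ c, volume {y : ℝ | ∀ j, s j y = c j} = 0` whenever ONE symbol `s j₀` has that shape; **`hline_of_satakeSymbol`** — the same with `t := k·log q`, `1 < q`,
  `k ≠ 0` (the Satake parametrisation `q^{±iyk}`).
HONEST LABEL: HC_CM is proved only modulo the 7 printed citations (2 remaining named inputs: hLiu418 = `stmt-HodgeConjecture-24832`, h413 = `stmt-HodgeConjecture-24833`) until rung 0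
closes; this pays (L3) only GIVEN the symbol shape — the symbols themselves (PB-3a, unramified Hecke action on flat sections) and the model (PB-2∕PB-3) are NOT claimed; REL ≠ ★ ≠ BUILT;
this file asserts no named fact and closes no socket; count-neutral; unconditional.

## References
* [ReedSimonI1980] M. Reed, B. Simon, *Methods of Modern Mathematical Physics I* (1980), §VII.2 (spectral measures; level sets of analytic multipliers).
* [Conway1978] J. B. Conway, *Functions of One Complex Variable* (2nd ed., 1978), IV §3 (identity theorem).
* [Cartier1979] P. Cartier, *Representations of p-adic groups: a survey*, PSPM 33.1 (1979), §IV (Satake isomorphism; unramified Hecke eigenvalues `q^{±s}`).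
-/

set_option autoImplicit false
set_option linter.dupNamespace false  -- the mandated namespace `…HodgeConjecture.HodgeConjecture.R90.S8` (LEAD #1 L1) repeats the summit's segment

noncomputable section

open MeasureTheory Set Filter Topology Real
open Summit.HodgeConjecture.HodgeConjecture.Cruxes.H413.K2E1AnalyticLevelSetNullU

namespace Summit.HodgeConjecture.HodgeConjecture.R90.S8

/-! ## §1 A Satake-shaped symbol is not constant along the axis -/

/-- **`y ↦ a·e^{ity} + b·e^{−ity} + c` IS NOT CONSTANT** for `t ≠ 0` and `(a, b) ≠ (0, 0)`: the values at `y = 0`, `y = π∕t`, `y = π∕(2t)` are `a + b + c`, `−a − b + c`, `(a − b)i + c`, and their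
coincidence forces `a = b = 0`. [cite: Conway1978, IV §3] -/
theorem expSymbol_not_const (a b c₀ : ℂ) (t : ℝ) (ht : t ≠ 0) (hab : a ≠ 0 ∨ b ≠ 0) :
    ∃ z z' : ℂ, a * Complex.exp ((t : ℂ) * z) + b * Complex.exp (-((t : ℂ) * z)) + c₀ ≠ a * Complex.exp ((t : ℂ) * z') + b * Complex.exp (-((t : ℂ) * z')) + c₀ := by
  by_contra hall
  push Not at hall
  have ht' : (t : ℂ) ≠ 0 := Complex.ofReal_ne_zero.2 ht
  -- the three evaluations
  have e0 : a * Complex.exp ((t : ℂ) * 0) + b * Complex.exp (-((t : ℂ) * 0)) + c₀ = a + b + c₀ := by simp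
  have eπ : a * Complex.exp ((t : ℂ) * (((π / t : ℝ) : ℂ) * Complex.I)) + b * Complex.exp (-((t : ℂ) * (((π / t : ℝ) : ℂ) * Complex.I))) + c₀ = -a - b + c₀ := by
    have h : (t : ℂ) * (((π / t : ℝ) : ℂ) * Complex.I) = π * Complex.I := by push_cast; field_simp
    rw [h, Complex.exp_neg, Complex.exp_pi_mul_I]
    ring
  have eπ2 : a * Complex.exp ((t : ℂ) * (((π / (2 * t) : ℝ) : ℂ) * Complex.I)) + b * Complex.exp (-((t : ℂ) * (((π / (2 * t) : ℝ) : ℂ) * Complex.I))) + c₀ =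
      (a - b) * Complex.I + c₀ := by
    have h : (t : ℂ) * (((π / (2 * t) : ℝ) : ℂ) * Complex.I) = (π / 2 : ℂ) * Complex.I := by push_cast; field_simp
    have hexp : Complex.exp ((π / 2 : ℂ) * Complex.I) = Complex.I := by
      rw [Complex.exp_mul_I, Complex.cos_pi_div_two, Complex.sin_pi_div_two, zero_add, one_mul]
    rw [h, Complex.exp_neg, hexp, Complex.inv_I]
    ring
  have h1 := hall 0 (((π / t : ℝ) : ℂ) * Complex.I)
  have h2 := hall 0 (((π / (2 * t) : ℝ) : ℂ) * Complex.I)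
  rw [e0, eπ] at h1
  rw [e0, eπ2] at h2
  have hab0 : a + b = 0 := by linear_combination h1 / 2
  have hI : (a - b) * Complex.I = 0 := by linear_combination hab0 - h2
  have hamb : a - b = 0 := by
    rcases mul_eq_zero.1 hI with h | h
    · exact h
    · exact absurd h Complex.I_ne_zero
  have ha : a = 0 := by linear_combination (hab0 + hamb) / 2
  have hb : b = 0 := by linear_combination (hab0 - hamb) / 2
  rcases hab with h | h
  · exact h ha
  · exact h hb

/-! ## §2 The (L3) letter `hline` for one Satake-shaped symbol -/

/-- **`hline` FOR A SYMBOL FAMILY WITH ONE SATAKE-SHAPED MEMBER** (the (L3) letter of ★ D5′ ∕ ★ `hNblk_of_record_of_conv` on the model space `(ℝ, volume)`): if `s j₀ y = a·e^{ity} + b·e^{−ity} + c`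
with `t ≠ 0`, `(a, b) ≠ (0, 0)`, then every joint level set `{y | ∀ j, s j y = c j}` is Lebesgue-null — restriction of the entire `S(z) = a e^{tz} + b e^{−tz} + c` to the line `y ↦ y·i`,
★ (α) `volume_levelSet_line_eq_zero` with §1, then ★ (α) `measure_inter_setOf_forall_eq_zero_of_exists`. [cite: ReedSimonI1980, §VII.2] [cite: Conway1978, IV §3] -/
theorem hline_of_expSymbol {J : Type*} (s : J → ℝ → ℂ) (j₀ : J) (a b c₀ : ℂ) (t : ℝ) (ht : t ≠ 0) (hab : a ≠ 0 ∨ b ≠ 0)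
    (hs : ∀ y : ℝ, s j₀ y = a * Complex.exp (((t * y : ℝ) : ℂ) * Complex.I) + b * Complex.exp (-(((t * y : ℝ) : ℂ) * Complex.I)) + c₀) :
    ∀ c : J → ℂ, volume {y : ℝ | ∀ j, s j y = c j} = 0 := by
  intro c
  set S : ℂ → ℂ := fun z => a * Complex.exp ((t : ℂ) * z) + b * Complex.exp (-((t : ℂ) * z)) + c₀ with hS
  have hSan : AnalyticOnNhd ℂ S univ := fun z _ => by
    rw [hS]
    exact ((analyticAt_const.mul (analyticAt_const.mul analyticAt_id).cexp).add (analyticAt_const.mul (analyticAt_const.mul analyticAt_id).neg.cexp)).add analyticAt_const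
  have hnc : ∃ z ∈ (univ : Set ℂ), ∃ z' ∈ (univ : Set ℂ), S z ≠ S z' := by
    obtain ⟨z, z', h⟩ := expSymbol_not_const a b c₀ t ht hab
    exact ⟨z, mem_univ _, z', mem_univ _, h⟩
  have hSy : ∀ y : ℝ, S (0 + (y : ℂ) * Complex.I) = s j₀ y := fun y => by
    rw [hs, hS]
    push_cast
    ring_nf
  have hkey : volume {y : ℝ | s j₀ y = c j₀} = 0 := by
    have h := volume_levelSet_line_eq_zero isPreconnected_univ hSan 0 Complex.I Complex.I_ne_zero (fun _ => mem_univ _) hnc (c j₀)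
    have hset : {y : ℝ | s j₀ y = c j₀} = {y : ℝ | S (0 + (y : ℂ) * Complex.I) = c j₀} := Set.ext fun y => by rw [mem_setOf_eq, mem_setOf_eq, hSy]
    rw [hset]
    exact h
  have h := measure_inter_setOf_forall_eq_zero_of_exists volume s c univ ⟨j₀, by rw [univ_inter]; exact hkey⟩
  rwa [univ_inter] at h

/-- **`hline` FOR A SATAKE SYMBOL `a·q^{iyk} + b·q^{−iyk} + c`** (`1 < q`, `k ≠ 0`, `(a, b) ≠ 0`; `q^{±iyk} = e^{±i(k log q)y}`): the joint level sets of the symbol family are Lebesgue-null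
— §2 with `t := k·log q ≠ 0`. [cite: Cartier1979, §IV] [cite: ReedSimonI1980, §VII.2] -/
theorem hline_of_satakeSymbol {J : Type*} (s : J → ℝ → ℂ) (j₀ : J) (a b c₀ : ℂ) (q k : ℝ) (hq : 1 < q) (hk : k ≠ 0) (hab : a ≠ 0 ∨ b ≠ 0)
    (hs : ∀ y : ℝ, s j₀ y = a * Complex.exp (((k * Real.log q * y : ℝ) : ℂ) * Complex.I) + b * Complex.exp (-(((k * Real.log q * y : ℝ) : ℂ) * Complex.I)) + c₀) :
    ∀ c : J → ℂ, volume {y : ℝ | ∀ j, s j y = c j} = 0 :=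
  hline_of_expSymbol s j₀ a b c₀ (k * Real.log q) (mul_ne_zero hk (Real.log_pos hq).ne') hab hs

end Summit.HodgeConjecture.HodgeConjecture.R90.S8

end
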